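import Summits.CriticalPhenomena.CardyFormulaZ2.Theorems.CardyComplexConeEdgePrecompactUFRSMarkedDecayRectMono

/-!
# UFRS, decay at the marked points (rectangles), part 3: the NEAR branch
(line `qkz-strip-boundary-arm` of crux `CardyComplexCone.EdgePrecompact`, stmt-CriticalPhenomena-11387;
support for the registered sub-goal `ufrs_markedPointDecay_rect`, wave 3 of lead c4)

The NEAR branch of the UFRS certificate at a collar point `z` (inner radius `4η`, outer radius
`ρ/2`) is "a marked edge within `256 η` of `z` and two strand-crossings of `A(z; 512 η, ρ/4)`",
hence two strand-crossings of `A(m; 768 η, ρ/4 - 256 η)` around the midpoint `m` of one of the at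
most four marked edges of the two data (`ufrsCertNear_subset_W3M`). Given the JUNCTION TWO-STRAND
DECAY at the marked edges (the registered bridge `ufrs_rect_junctionTwoStrandDecay`, here the
hypothesis `hJ` read at one datum: `P(ufrsStrands E w m 2 s S) ≤ C (s/S)^β` for `η ≤ s`, `0 < S`),
a union bound gives `ufrs_nearBranch_le_W3M`:
`P{ω | ∃ z ∈ Ω, infDist z Ωᶜ < 3η ∧ ω ∈ ufrsCertNear E w z (4η) (ρ/2)} ≤ 4 C (6144 η/ρ)^β`
for `η ≤ ρ/4096` — no box count is needed near the marked points.

References: G. F. Lawler, O. Schramm, W. Werner, Electron. J. Probab. 7 (2002), Appendix A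
(half-plane arm events); S. Smirnov, C. R. Acad. Sci. Paris 333 (2001), §2.
-/

namespace Summit.CriticalPhenomena.CardyFormulaZ2.Cruxes.EdgePrecompact.QkzStripBoundaryArm

open MeasureTheory Filter Set Metric
open scoped Topology BigOperators Pointwise
open Literature.Probability.LatticeModels Literature.Probability.Percolation
open Literature.Probability.RandomPlanarGeometry (DobrushinDomain)
open Summit.CriticalPhenomena.CardyFormulaZ2.Theses.CardyComplexCone

noncomputable section

/-- The ratio of the radii of the NEAR annulus: `768 η / (ρ/4 - 256 η) ≤ 6144 η / ρ` once
`η ≤ ρ / 4096` (then `ρ/4 - 256 η ≥ ρ/8`). -/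
theorem near_ratio_le_W3M {η ρ : ℝ} (hη : 0 < η) (hηρ : η ≤ ρ / 4096) :
    0 < ρ / 4 - 256 * η ∧ 768 * η / (ρ / 4 - 256 * η) ≤ 6144 * η / ρ := by
  have hρ : 0 < ρ := by linarith
  have h8 : ρ / 8 ≤ ρ / 4 - 256 * η := by linarith
  refine ⟨by linarith, ?_⟩
  rw [div_le_div_iff₀ (by linarith) hρ]
  nlinarith

/-- **Decay of the NEAR branch** (registered sub-goal `ufrs_nearBranch_le_W3M`). For an admissible
datum `E`, a shift `w`, `0 < η ≤ ρ/4096`, and the junction two-strand decay at the marked edges of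
`E` and `shiftData E w` with constants `C`, `β` (hypothesis `hJ`), the NEAR event over any set `Ω`
has probability at most `4 C (6144 η / ρ)^β`. -/
theorem ufrs_nearBranch_le_W3M : ∀ (E : DiscreteDobrushin) (w : Site 2) (η ρ C β : ℝ), E.IsZdAdmissible → 0 < η → η ≤ ρ / 4096 → 0 ≤ C → 0 < β → (∀ e₀ : Sym2 (Site 2), (e₀ ∈ E.zdABEdges ∨ e₀ ∈ (shiftData E w).zdABEdges) → ∀ s S : ℝ, η ≤ s → 0 < S → (bondPercolation (zdGraph 2) half).real (ufrsStrands E w (medialPoint E.δ e₀) 2 s S) ≤ C * (s / S) ^ β) → ∀ Ω : Set ℂ, (bondPercolation (zdGraph 2) half).real {ω : BondConfig (Site 2) | ∃ z ∈ Ω, infDist z Ωᶜ < 3 * η ∧ ω ∈ ufrsCertNear E w z (4 * η) (ρ / 2)} ≤ 4 * C * (6144 * η / ρ) ^ β := by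
  intro E w η ρ C β hE hη hηρ hC hβ hJ Ω
  obtain ⟨hpos, hratio⟩ := near_ratio_le_W3M hη hηρ
  have hρ : 0 < ρ := by linarith
  set μ := bondPercolation (zdGraph 2) half with hμ
  -- each marked edge costs `C (6144 η / ρ)^β`
  have hterm : ∀ e₀ ∈ (finite_markedEdges_W3M hE w).toFinset,
      μ.real (ufrsStrands E w (medialPoint E.δ e₀) 2 (768 * η) (ρ / 4 - 256 * η)) ≤ C * (6144 * η / ρ) ^ β := by
    intro e₀ he₀
    refine le_trans (hJ e₀ ((mem_markedEdges_toFinset_W3M hE w e₀).1 he₀) _ _ (by linarith) hpos) ?_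
    refine mul_le_mul_of_nonneg_left (Real.rpow_le_rpow (by positivity) hratio hβ.le) hC
  calc μ.real {ω : BondConfig (Site 2) | ∃ z ∈ Ω, infDist z Ωᶜ < 3 * η ∧ ω ∈ ufrsCertNear E w z (4 * η) (ρ / 2)}
      ≤ μ.real (⋃ e₀ ∈ (finite_markedEdges_W3M hE w).toFinset,
          ufrsStrands E w (medialPoint E.δ e₀) 2 (768 * η) (ρ / 4 - 256 * η)) :=
        measureReal_mono (setOf_ufrsCertNear_subset_W3M hE w η ρ Ω) (measure_ne_top _ _)
    _ ≤ ∑ e₀ ∈ (finite_markedEdges_W3M hE w).toFinset,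
          μ.real (ufrsStrands E w (medialPoint E.δ e₀) 2 (768 * η) (ρ / 4 - 256 * η)) :=
        measureReal_biUnion_finset_le _ _
    _ ≤ ∑ _e₀ ∈ (finite_markedEdges_W3M hE w).toFinset, C * (6144 * η / ρ) ^ β := Finset.sum_le_sum hterm
    _ = (finite_markedEdges_W3M hE w).toFinset.card * (C * (6144 * η / ρ) ^ β) := by
        rw [Finset.sum_const, nsmul_eq_mul]
    _ ≤ 4 * (C * (6144 * η / ρ) ^ β) := by
        refine mul_le_mul_of_nonneg_right ?_ (by positivity)
        exact_mod_cast card_markedEdges_le_W3M hE w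
    _ = 4 * C * (6144 * η / ρ) ^ β := by ring

end

end Summit.CriticalPhenomena.CardyFormulaZ2.Cruxes.EdgePrecompact.QkzStripBoundaryArm
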